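import Summits.Ventures.PercRepro.S2MidFlatsTenB

/-!
# PercRepro — S2: THE MID SPANNING SETS AT CORANK `10` ON `≤ 31` POINTS (p7, gen 6; sub-claim S2; the cell `(20, 10)`)

S2MidFlatsTenB's `card_spanMid_le_ten` word for word with the hypothesis `|E| = 31` weakened to `|E| ≤ 31` (it is used only
as an upper bound on the disjoint 2-point complements): **`card_spanMid_le_ten_le`** — `(spanMid M 5 10 9).card ≤ 136092` on
every e-free core of corank `10` with `≤ 31` points; at `p = 20` (`|E| = 30`) it closes the cell `(20, 10)` with the mid class
explicit. Axioms: standard.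
-/

open scoped Matroid

namespace PercRepro

namespace S2

open Set Finset

variable {α : Type} {M : Matroid α}

open scoped Classical in
/-- **The mid spanning sets at corank `10` on `≤ 31` points number at most `136,092`.** -/
theorem card_spanMid_le_ten_le [M.Finite]
    (hC1 : ∀ L ⊆ M.E, M.eRk L = 2 → L.ncard ≤ 3)
    (hflat' : ∀ X ⊆ M.E, M.eRk X ≤ ((5 - 1 : ℕ) : ℕ∞) → X.ncard ≤ 10)
    (hC2 : ∀ P ⊆ M.E, M.eRk P ≤ 3 → P.ncard ≤ 6) (hC0 : ∀ X ⊆ M.E, M.eRk X ≤ 1 → X.ncard ≤ 1)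
    (hd : M.E.encard = M.eRank + 10) (hn : M.E.ncard ≤ 31) :
    (spanMid M 5 10 9).card ≤ 136092 := by
  set 𝓕 : Finset (Set α) := (spanMid M 5 10 9).image (fun S => M.closure S) with h𝓕
  have hdata : ∀ F ∈ 𝓕, F ⊆ M.E ∧ M.eRk F = 5 ∧ 12 ≤ F.ncard ∧ F.ncard ≤ 13 ∧ M.closure F = F := by
    intro F hF
    rw [h𝓕, Finset.mem_image] at hF
    obtain ⟨S, hS, rfl⟩ := hF
    obtain ⟨-, hr, hc1, hc2⟩ := closure_mid_ten hS
    exact ⟨M.closure_subset_ground _, hr, hc1, hc2, M.closure_closure _⟩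
  -- each closure `F` carries at most `C(|F|, 6)` spanning sets
  have hper : ∀ F ∈ 𝓕, ((spanMid M 5 10 9).filter (fun S => M.closure S = F)).card ≤ F.ncard.choose 6 := by
    intro F hF
    obtain ⟨hFE, -, -, -, -⟩ := hdata F hF
    have hFfin : F.Finite := M.ground_finite.subset hFE
    have k1 : ((spanMid M 5 10 9).filter (fun S => M.closure S = F)).card
        ≤ (Matroid.subsF hFfin.toFinset 6).card := by
      apply Finset.card_le_card
      intro S hS
      rw [Finset.mem_filter] at hS
      obtain ⟨hSm, hScl⟩ := hS
      obtain ⟨hSa, -, -, -⟩ := closure_mid_ten hSm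
      obtain ⟨hSE, hSc, -⟩ := mem_spanAll.1 hSa
      apply Matroid.mem_subsF_of _ hSc
      rw [Set.Finite.coe_toFinset, ← hScl]
      exact M.subset_closure S hSE
    have k2 := Matroid.card_subsF_le hFfin.toFinset 6
    rw [← Set.ncard_eq_toFinset_card _ hFfin] at k2
    exact k1.trans k2
  have hsplit : (spanMid M 5 10 9).card ≤ ∑ F ∈ 𝓕, F.ncard.choose 6 := by
    have h1 : spanMid M 5 10 9 =
        𝓕.biUnion (fun F => (spanMid M 5 10 9).filter (fun S => M.closure S = F)) := by
      ext S
      rw [Finset.mem_biUnion]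
      constructor
      · intro hS
        exact ⟨M.closure S, Finset.mem_image_of_mem _ hS, Finset.mem_filter.2 ⟨hS, rfl⟩⟩
      · rintro ⟨F, -, hS⟩
        exact (Finset.mem_filter.1 hS).1
    rw [h1]
    exact Finset.card_biUnion_le.trans (Finset.sum_le_sum hper)
  -- `C(|F|, 6) = 924 + 792·(|F| − 12)` on `{12, 13}`
  have hchoose : ∀ F ∈ 𝓕, F.ncard.choose 6 = 924 + 792 * (F.ncard - 12) := by
    intro F hF
    obtain ⟨-, -, hc1, hc2, -⟩ := hdata F hF
    rcases (show F.ncard = 12 ∨ F.ncard = 13 by omega) with h | h <;> rw [h] <;> decide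
  have hsum : ∑ F ∈ 𝓕, F.ncard.choose 6 = 924 * 𝓕.card + 792 * ∑ F ∈ 𝓕, (F.ncard - 12) := by
    rw [Finset.sum_congr rfl hchoose, Finset.sum_add_distrib, Finset.sum_const, smul_eq_mul, mul_comm,
      Finset.mul_sum]
  -- the number of `13`-point closures
  set b : ℕ := ∑ F ∈ 𝓕, (F.ncard - 12) with hb
  have hb_le : b ≤ 𝓕.card := by
    rw [hb]
    calc ∑ F ∈ 𝓕, (F.ncard - 12) ≤ ∑ _F ∈ 𝓕, 1 :=
          Finset.sum_le_sum (fun F hF => by obtain ⟨-, -, -, hc2, -⟩ := hdata F hF; omega)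
      _ = 𝓕.card := by rw [Finset.sum_const, smul_eq_mul, mul_one]
  refine hsplit.trans (hsum.trans_le ?_)
  -- the main count: `924·|𝓕| + 792·b ≤ 136092`
  suffices hmain : 924 * 𝓕.card + 792 * b ≤ 136092 by exact hmain
  rcases Nat.lt_or_ge 𝓕.card 2 with hlt | hge
  · omega
  obtain ⟨F₁, hF₁, F₂, hF₂, hne⟩ := Finset.one_lt_card.1 hge
  obtain ⟨h₁E, h₁r, h₁c, h₁c', h₁cl⟩ := hdata F₁ hF₁
  obtain ⟨h₂E, h₂r, h₂c, h₂c', h₂cl⟩ := hdata F₂ hF₂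
  obtain ⟨hI₁₂r, hI₁₂c, hU₁₂r⟩ :=
    two_heavy_flats_ten hC1 hflat' hC2 hC0 hd h₁E h₂E h₁r h₂r h₁c h₂c h₁cl h₂cl hne
  set W := M.closure (F₁ ∪ F₂) with hW
  have hWE : W ⊆ M.E := M.closure_subset_ground _
  have hWfin : W.Finite := M.ground_finite.subset hWE
  have hWcl : M.closure W = W := M.closure_closure _
  have hWr : M.eRk W = 6 := by rw [hW, M.eRk_closure_eq, hU₁₂r]
  have hW₁ : F₁ ⊆ W := Set.subset_union_left.trans (M.subset_closure _ (Set.union_subset h₁E h₂E))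
  have hW₂ : F₂ ⊆ W := Set.subset_union_right.trans (M.subset_closure _ (Set.union_subset h₁E h₂E))
  -- `14 ≤ |W| ≤ 16`
  have hWc16 : W.ncard ≤ 16 := by
    have hcap := Matroid.encard_le_eRk_add_of_encard_eq (M := M) hWE hd
    rw [hWr, ← hWfin.cast_ncard_eq] at hcap
    exact_mod_cast hcap
  have hWc14 : 14 ≤ W.ncard := by
    have h₁fin : F₁.Finite := M.ground_finite.subset h₁E
    have h₂fin : F₂.Finite := M.ground_finite.subset h₂E
    have hcard := Set.ncard_union_add_ncard_inter F₁ F₂ h₁fin h₂fin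
    have hle : (F₁ ∪ F₂).ncard ≤ W.ncard := Set.ncard_le_ncard (Set.union_subset hW₁ hW₂) hWfin
    omega
  have hfin : ∀ F ∈ 𝓕, F.Finite := fun F hF => M.ground_finite.subset (hdata F hF).1
  -- two distinct closures meet in `≤ 10` points, so their union has `≥ 14`
  have hunion : ∀ F ∈ 𝓕, ∀ F' ∈ 𝓕, F ≠ F' → 14 ≤ (F ∪ F').ncard ∧ F.ncard + F'.ncard ≤ (F ∪ F').ncard + 10 := by
    intro F hF F' hF' hne'
    obtain ⟨hFE, hFr, hFc, -, hFcl⟩ := hdata F hF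
    obtain ⟨hF'E, hF'r, hF'c, -, hF'cl⟩ := hdata F' hF'
    obtain ⟨-, hI, -⟩ := two_heavy_flats_ten hC1 hflat' hC2 hC0 hd hFE hF'E hFr hF'r hFc hF'c hFcl hF'cl hne'
    have hcard := Set.ncard_union_add_ncard_inter F F' (hfin F hF) (hfin F' hF')
    omega
  by_cases hTop : ∀ F ∈ 𝓕, F ⊆ W
  · -- TOP: all closures inside `W`
    set k : ℕ := W.ncard - 13 with hk
    let cF : Set α → Finset α := fun F => hWfin.toFinset.filter (fun x => x ∉ F)
    have hcF : ∀ F ∈ 𝓕, (cF F).card = W.ncard - F.ncard := fun F hF =>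
      card_filter_not_mem_of_subset hWfin (hTop F hF)
    -- two complements share exactly `|W| − |F ∪ F′|` points, at most `|W| − 14`
    have hcFinter_eq : ∀ F ∈ 𝓕, ∀ F' ∈ 𝓕, (cF F ∩ cF F').card = W.ncard - (F ∪ F').ncard := by
      intro F hF F' hF'
      have hsub : cF F ∩ cF F' = hWfin.toFinset.filter (fun x => x ∉ F ∪ F') := by
        ext x
        simp only [cF, Finset.mem_inter, Finset.mem_filter, Set.mem_union, not_or]
        tauto
      rw [hsub, card_filter_not_mem_of_subset hWfin (Set.union_subset (hTop F hF) (hTop F' hF'))]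
    have hcFinter : ∀ F ∈ 𝓕, ∀ F' ∈ 𝓕, F ≠ F' → (cF F ∩ cF F').card ≤ W.ncard - 14 := by
      intro F hF F' hF' hne'
      rw [hcFinter_eq F hF F' hF']
      have := (hunion F hF F' hF' hne').1
      omega
    -- the `k`-subsets of the complements are pairwise disjoint families inside the `k`-subsets of `W`
    have hdisj : ∀ F ∈ 𝓕, ∀ F' ∈ 𝓕, F ≠ F' →
        Disjoint (Finset.powersetCard k (cF F)) (Finset.powersetCard k (cF F')) := by
      intro F hF F' hF' hne'
      rw [Finset.disjoint_left]
      intro T hT hT'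
      rw [Finset.mem_powersetCard] at hT hT'
      have hTsub : T ⊆ cF F ∩ cF F' := Finset.subset_inter hT.1 hT'.1
      have := Finset.card_le_card hTsub
      have := hcFinter F hF F' hF' hne'
      omega
    have hbi := Finset.card_biUnion (s := 𝓕) (t := fun F => Finset.powersetCard k (cF F)) hdisj
    have hle : ∑ F ∈ 𝓕, (cF F).card.choose k ≤ W.ncard.choose k := by
      calc ∑ F ∈ 𝓕, (cF F).card.choose k = ∑ F ∈ 𝓕, (Finset.powersetCard k (cF F)).card :=
            Finset.sum_congr rfl (fun F _ => (Finset.card_powersetCard k (cF F)).symm)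
        _ = (𝓕.biUnion (fun F => Finset.powersetCard k (cF F))).card := hbi.symm
        _ ≤ (Finset.powersetCard k hWfin.toFinset).card := by
            apply Finset.card_le_card
            intro T hT
            rw [Finset.mem_biUnion] at hT
            obtain ⟨F, -, hT⟩ := hT
            exact Finset.powersetCard_mono (Finset.filter_subset _ _) hT
        _ = W.ncard.choose k := by rw [Finset.card_powersetCard, Set.ncard_eq_toFinset_card _ hWfin]
    -- `C(|W| − |F|, k) + k·(|F| − 12) = k + 1` for every closure
    have hterm : ∀ F ∈ 𝓕, (cF F).card.choose k + k * (F.ncard - 12) = k + 1 := by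
      intro F hF
      obtain ⟨-, -, hc1, hc2, -⟩ := hdata F hF
      rw [hcF F hF]
      rcases (show F.ncard = 12 ∨ F.ncard = 13 by omega) with h | h
      · rw [h, show W.ncard - 12 = k + 1 by omega, Nat.choose_succ_self_right]; omega
      · rw [h, show W.ncard - 13 = k by omega, Nat.choose_self]; omega
    have hcount : (k + 1) * 𝓕.card ≤ W.ncard.choose k + k * b := by
      have h1 : ∑ F ∈ 𝓕, ((cF F).card.choose k + k * (F.ncard - 12)) = (k + 1) * 𝓕.card := by
        rw [Finset.sum_congr rfl hterm, Finset.sum_const, smul_eq_mul, mul_comm]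
      rw [Finset.sum_add_distrib, ← Finset.mul_sum, ← hb] at h1
      omega
    -- at most one `13`-point closure unless `|W| = 16`, and then at most five
    have h13 : b ≤ 1 ∨ (W.ncard = 16 ∧ b ≤ 5) := by
      set 𝓕₁₃ := 𝓕.filter (fun F => F.ncard = 13) with h𝓕₁₃
      have hb13 : b = 𝓕₁₃.card := by
        rw [hb, ← Finset.sum_filter_add_sum_filter_not 𝓕 (fun F => F.ncard = 13)]
        have e1 : ∑ F ∈ 𝓕.filter (fun F => F.ncard = 13), (F.ncard - 12) = 𝓕₁₃.card := by
          rw [Finset.card_eq_sum_ones]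
          exact Finset.sum_congr rfl (fun F hF => by rw [(Finset.mem_filter.1 hF).2])
        have e2 : ∑ F ∈ 𝓕.filter (fun F => ¬ F.ncard = 13), (F.ncard - 12) = 0 := by
          apply Finset.sum_eq_zero
          intro F hF
          obtain ⟨-, -, hc1, hc2, -⟩ := hdata F (Finset.mem_filter.1 hF).1
          have := (Finset.mem_filter.1 hF).2
          omega
        rw [e1, e2, add_zero]
      rcases Nat.lt_or_ge 𝓕₁₃.card 2 with hlt | hge
      · left; omega
      right
      obtain ⟨G₁, hG₁, G₂, hG₂, hGne⟩ := Finset.one_lt_card.1 hge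
      have hG₁' := Finset.mem_filter.1 hG₁
      have hG₂' := Finset.mem_filter.1 hG₂
      have hu := hunion G₁ hG₁'.1 G₂ hG₂'.1 hGne
      have hW16 : W.ncard = 16 := by
        have := Set.ncard_le_ncard (Set.union_subset (hTop G₁ hG₁'.1) (hTop G₂ hG₂'.1)) hWfin
        omega
      refine ⟨hW16, ?_⟩
      -- the `3`-point complements of the `13`-point closures are pairwise disjoint inside `W`
      have hdisj13 : ∀ F ∈ 𝓕₁₃, ∀ F' ∈ 𝓕₁₃, F ≠ F' → Disjoint (cF F) (cF F') := by
        intro F hF F' hF' hne'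
        have hFm := Finset.mem_filter.1 hF
        have hF'm := Finset.mem_filter.1 hF'
        rw [Finset.disjoint_iff_inter_eq_empty, ← Finset.card_eq_zero, hcFinter_eq F hFm.1 F' hF'm.1]
        have := (hunion F hFm.1 F' hF'm.1 hne').2
        have := Set.ncard_le_ncard (Set.union_subset (hTop F hFm.1) (hTop F' hF'm.1)) hWfin
        omega
      have hbi13 := Finset.card_biUnion (s := 𝓕₁₃) (t := cF) hdisj13
      have hle13 : (𝓕₁₃.biUnion cF).card ≤ W.ncard := by
        rw [Set.ncard_eq_toFinset_card _ hWfin]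
        apply Finset.card_le_card
        intro x hx
        rw [Finset.mem_biUnion] at hx
        obtain ⟨F, -, hx⟩ := hx
        exact (Finset.mem_filter.1 hx).1
      have hsum13 : ∑ F ∈ 𝓕₁₃, (cF F).card = 𝓕₁₃.card * 3 := by
        apply Finset.sum_const_nat
        intro F hF
        have hF' := Finset.mem_filter.1 hF
        rw [hcF F hF'.1, hF'.2, hW16]
      rw [hbi13, hsum13] at hle13
      omega
    -- the arithmetic, by the size of `W`
    have hC : W.ncard = 14 ∧ k = 1 ∨ W.ncard = 15 ∧ k = 2 ∨ W.ncard = 16 ∧ k = 3 := by omega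
    rcases hC with ⟨hW', hk'⟩ | ⟨hW', hk'⟩ | ⟨hW', hk'⟩ <;> rw [hW', hk'] at hcount <;>
      simp only [show (14 : ℕ).choose 1 = 14 by decide, show (15 : ℕ).choose 2 = 105 by decide,
        show (16 : ℕ).choose 3 = 560 by decide] at hcount <;> omega
  · -- STAR: some closure leaves `W`; every closure contains `K = F₁ ∩ F₂`, pairwise meeting exactly in `K`
    push Not at hTop
    obtain ⟨F₃, hF₃, hF₃W⟩ := hTop
    obtain ⟨h₃E, h₃r, h₃c, h₃c', h₃cl⟩ := hdata F₃ hF₃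
    have h₁₃ : F₁ ≠ F₃ := fun h => hF₃W (h ▸ hW₁)
    have h₂₃ : F₂ ≠ F₃ := fun h => hF₃W (h ▸ hW₂)
    set K := F₁ ∩ F₂ with hK
    have hKcl : M.closure K = K := closure_inter_eq_of_closure_eq h₁cl h₂cl
    have hKE : K ⊆ M.E := Set.inter_subset_left.trans h₁E
    obtain ⟨hK₁₃, hK₂₃⟩ :=
      (heavy_triple_top_or_star hC1 hflat' hC2 hC0 hd h₁E h₂E h₃E h₁r h₂r h₃r h₁c h₂c h₃c h₁cl h₂cl h₃cl
        hne h₁₃ h₂₃).resolve_left hF₃W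
    -- every other closure meets `F₁` exactly in `K`
    have hK₁ : ∀ F ∈ 𝓕, F ≠ F₁ → F₁ ∩ F = K := by
      intro F hF hF₁
      obtain ⟨hFE, hFr, hFc, -, hFcl⟩ := hdata F hF
      by_cases hF₂ : F = F₂
      · rw [hF₂]
      by_cases hF₃' : F = F₃
      · rw [hF₃']; exact hK₁₃
      rcases heavy_triple_top_or_star hC1 hflat' hC2 hC0 hd h₁E h₂E hFE h₁r h₂r hFr h₁c h₂c hFc h₁cl h₂cl hFcl
          hne (Ne.symm hF₁) (Ne.symm hF₂) with hT₁₂ | ⟨hs, -⟩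
      · rcases heavy_triple_top_or_star hC1 hflat' hC2 hC0 hd h₁E h₃E hFE h₁r h₃r hFr h₁c h₃c hFc h₁cl h₃cl
            hFcl h₁₃ (Ne.symm hF₁) (Ne.symm hF₃') with hT₁₃ | ⟨hs, -⟩
        · -- `F` lies in both rank-`6` hulls, which meet exactly in `F₁`
          exfalso
          set W' := M.closure (F₁ ∪ F₃) with hW'
          obtain ⟨-, -, hU₁₃r⟩ :=
            two_heavy_flats_ten hC1 hflat' hC2 hC0 hd h₁E h₃E h₁r h₃r h₁c h₃c h₁cl h₃cl h₁₃
          have hW'r : M.eRk W' = 6 := by rw [hW', M.eRk_closure_eq, hU₁₃r]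
          have hW'cl : M.closure W' = W' := M.closure_closure _
          have hW'E : W' ⊆ M.E := M.closure_subset_ground _
          have hJcl : M.closure (W ∩ W') = W ∩ W' := closure_inter_eq_of_closure_eq hWcl hW'cl
          have hJE : W ∩ W' ⊆ M.E := Set.inter_subset_left.trans hWE
          have hF₁J : F₁ ⊆ W ∩ W' :=
            Set.subset_inter hW₁ (Set.subset_union_left.trans (M.subset_closure _ (Set.union_subset h₁E h₃E)))
          have hJr : M.eRk (W ∩ W') ≤ 5 := by
            by_contra hcon
            push Not at hcon
            have hJr6 : M.eRk W ≤ M.eRk (W ∩ W') := by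
              rw [hWr]
              exact Order.add_one_le_of_lt hcon
            have hJW : W ∩ W' = W :=
              flat_eq_of_subset_of_eRk_eq hJE hJcl hWcl Set.inter_subset_left hJr6
            have hWW' : W ⊆ W' := by rw [← hJW]; exact Set.inter_subset_right
            have hWeq : W = W' :=
              flat_eq_of_subset_of_eRk_eq hWE hWcl hW'cl hWW' (by rw [hWr, hW'r])
            exact hF₃W (hWeq ▸ Set.subset_union_right.trans (M.subset_closure _ (Set.union_subset h₁E h₃E)))
          have hJF₁ : F₁ = W ∩ W' :=
            flat_eq_of_subset_of_eRk_eq h₁E h₁cl hJcl hF₁J (by rw [h₁r]; exact hJr)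
          have hFF₁ : F ⊆ F₁ := by rw [hJF₁]; exact Set.subset_inter hT₁₂ hT₁₃
          exact hF₁ (flat_eq_of_subset_of_eRk_eq hFE hFcl h₁cl hFF₁ (by rw [h₁r, hFr]))
        · rw [hs, hK₁₃]
      · exact hs
    -- hence every closure contains `K`, and two distinct closures meet exactly in `K`
    have hKsub : ∀ F ∈ 𝓕, K ⊆ F := by
      intro F hF
      by_cases hF₁ : F = F₁
      · rw [hF₁]; exact Set.inter_subset_left
      · rw [← hK₁ F hF hF₁]; exact Set.inter_subset_right
    have hKpair : ∀ F ∈ 𝓕, ∀ F' ∈ 𝓕, F ≠ F' → F ∩ F' = K := by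
      intro F hF F' hF' hne'
      obtain ⟨hFE, hFr, hFc, -, hFcl⟩ := hdata F hF
      obtain ⟨hF'E, hF'r, hF'c, -, hF'cl⟩ := hdata F' hF'
      obtain ⟨hIr, -, -⟩ := two_heavy_flats_ten hC1 hflat' hC2 hC0 hd hFE hF'E hFr hF'r hFc hF'c hFcl hF'cl hne'
      have hIcl : M.closure (F ∩ F') = F ∩ F' := closure_inter_eq_of_closure_eq hFcl hF'cl
      exact (flat_eq_of_subset_of_eRk_eq hKE hKcl hIcl (Set.subset_inter (hKsub F hF) (hKsub F' hF'))
        (by rw [hIr, hI₁₂r])).symm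
    -- the remainders `F ∖ K` are pairwise disjoint, with `≥ 2` points each, inside `E`
    have hEfin : M.E.Finite := M.ground_finite
    let dF : Set α → Finset α := fun F => hEfin.toFinset.filter (fun x => x ∈ F ∧ x ∉ K)
    have hdF : ∀ F ∈ 𝓕, 2 ≤ (dF F).card := by
      intro F hF
      obtain ⟨hFE, -, hFc, -, -⟩ := hdata F hF
      have hFfin : F.Finite := hfin F hF
      have hKfin : K.Finite := M.ground_finite.subset hKE
      have hdiff : dF F = (hFfin.sdiff (t := K)).toFinset := by
        ext x
        simp only [dF, Finset.mem_filter, Set.Finite.mem_toFinset, Set.mem_sdiff]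
        exact ⟨fun h => h.2, fun h => ⟨hFE h.1, h⟩⟩
      rw [hdiff, ← Set.ncard_eq_toFinset_card _ (hFfin.sdiff), Set.ncard_sdiff (hKsub F hF) hKfin]
      omega
    have hdFdisj : ∀ F ∈ 𝓕, ∀ F' ∈ 𝓕, F ≠ F' → Disjoint (dF F) (dF F') := by
      intro F hF F' hF' hne'
      rw [Finset.disjoint_left]
      intro x hx hx'
      simp only [dF, Finset.mem_filter] at hx hx'
      have : x ∈ F ∩ F' := ⟨hx.2.1, hx'.2.1⟩
      rw [hKpair F hF F' hF' hne'] at this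
      exact hx.2.2 this
    have hbiE := Finset.card_biUnion (s := 𝓕) (t := dF) hdFdisj
    have hleE : (𝓕.biUnion dF).card ≤ 31 := by
      refine le_trans ?_ hn
      rw [Set.ncard_eq_toFinset_card _ hEfin]
      apply Finset.card_le_card
      intro x hx
      rw [Finset.mem_biUnion] at hx
      obtain ⟨F, -, hx⟩ := hx
      exact (Finset.mem_filter.1 hx).1
    have hsumE : 𝓕.card * 2 ≤ ∑ F ∈ 𝓕, (dF F).card := by
      rw [← smul_eq_mul, ← Finset.sum_const]
      exact Finset.sum_le_sum hdF
    rw [hbiE] at hleE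
    omega

end S2

end PercRepro
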